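import Summits.Parity.GeneralizedHardyLittlewood.Theorems.PrimeLevelFamEdgeMomentsBeyondDiagonalDiagDecorBilinearTwoScale
import Summits.Parity.GeneralizedHardyLittlewood.Theorems.PrimeLevelFamEdgeMomentsBeyondDiagonalDiagDecorCollapseBounds
import HarnessLib

/-!
# Route `PrimeLevelFamEdge`, crux K_A `MomentsBeyondDiagonal` (stmt-Parity-20007), line «petersson_layers» v4, stub `stub_diag`:
# **the `(log g)^r`-monomials of the per-order targets are ERROR TERMS:
# `|Σ_{c≤⌊M⌋}Σ_{g≤⌊M⌋/c} μ(g)c(log g)^r·Σ_{k₁,k₂} y′(cgk₁)y′(cgk₂)t₁(k₁)t₂(k₂)| ≤ C·(1+log M)^r/log^{s₁+s₂}M`, `r ≥ 1`**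

Census R3(ii), ANALYTIC HALF — the companion of the product-monomial master step (`…DiagDecorMonomial`,
`…DiagDecorBilinearTwoScale`) for the monomials carrying a power of `log g` (`X = ℓ − log g` expanded). With the
collapse bound `…DiagDecorCollapseBounds.abs_selbergCollapse_logPow_le` (`(log N)^{r−1}Σ_n|W(n)|κ(n)|F(n)|`), the CRUDE
size of a decorated profile coordinate under the two-scale hypothesis, and `Σ_{n≤N}κ(n)D(n)²/n ≤ C(2+log N)`
(`KernelFormXSqSumsB.sum_kappa_divWeight_sq_div_le`):

* `abs_profileCoord_crude_le` — `|𝒮(n)| ≤ (C_E·B + 3C)·D(n)/log^sM` from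
  `|𝒮(n) − E_nR(u_n)/log^sM| ≤ C·D(n)((1+κ(n))/log^{s+1}M + 1/((1+log(M/n))²log^sM))` (`κ(n) ≤ log n ≤ log M`, `B = Σ|R_i|`);
* `abs_selbergMonomial_logPow_le` — **the bound displayed above** (`r ≥ 1`; same hypotheses as the master step).

Compared with the `log g`-free monomial of the same formal degree (`ℓ^r` in place of `(log g)^r`, main term
`≍ ℓ^r·log M/log^{s₁+s₂}M`), this is one logarithm smaller — exactly the precision of the per-order targets of
`…DiagOrderSelberg`. Def-free; theorems only. Helper `--supports stmt-Parity-20007`; closes nothing; K_A, K_B and the Parity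
summit are NOT proved; nothing about Landau–Siegel zeros.

## References
* E. Kowalski, P. Michel, J. VanderKam, J. reine angew. Math. 526 (2000), (23) p. 13 (the `κ(n)`-terms are lower order).
  [cite: KowalskiMichelVanderKam2000, (23)–(28) — derivation (log g monomials of the diagonal main term)]
-/

noncomputable section

open scoped Real ArithmeticFunction.Moebius
open Finset ArithmeticFunction Polynomial MeasureTheory intervalIntegral

namespace Summit.Parity.GeneralizedHardyLittlewood.Theorems.MomentsBeyondDiagonal.DiagKernel

open Literature.NumberTheory.LFunctions Literature.NumberTheory.LFunctions.KMV2000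
open MollifierMainTerm (W)
open SelbergCoord (kappa)
open Literature.NumberTheory.Sieve (one_le_log_of_three_le)
open Summit.Parity.GeneralizedHardyLittlewood.Theorems.BeyondDiagonalBeatsQuarter.KernelFormXSq
  (mainConst divWeight divWeight_nonneg mainConst_nonneg mainConst_le_divWeight abs_W_le sum_kappa_divWeight_sq_div_le)

/-! ### The crude size of a decorated profile coordinate -/

/-- **Crude size**: if `|S − E_nR(u_n)/log^sM| ≤ C·D(n)((1+κ(n))/log^{s+1}M + 1/((1+log(M/n))²log^sM))` for `M ≥ 3`,
`1 ≤ n ≤ M`, then `|S| ≤ (C_E·Σ|R_i| + 3C)·D(n)/log^sM` (one constant `C_E` with `E_n ≤ C_E D(n)`). [folklore] -/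
theorem abs_profileCoord_crude_le (R : ℝ[X]) (s : ℕ) (S : ℝ → ℕ → ℝ) {C : ℝ} (hC : 0 ≤ C)
    (h : ∀ M : ℝ, 3 ≤ M → ∀ n : ℕ, n ≠ 0 → (n : ℝ) ≤ M →
      |S M n - mainConst n * R.eval (Real.log (M / n) / Real.log M) / Real.log M ^ s| ≤
        C * divWeight n * ((1 + kappa n) / Real.log M ^ (s + 1) + 1 / ((1 + Real.log (M / n)) ^ 2 * Real.log M ^ s))) :
    ∃ K : ℝ, 0 ≤ K ∧ ∀ M : ℝ, 3 ≤ M → ∀ n : ℕ, n ≠ 0 → (n : ℝ) ≤ M →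
      |S M n| ≤ K * divWeight n / Real.log M ^ s := by
  obtain ⟨C_E, hC_E, hE⟩ := mainConst_le_divWeight
  set B : ℝ := ∑ i ∈ Finset.range (R.natDegree + 1), |R.coeff i| with hB
  have hB0 : 0 ≤ B := Finset.sum_nonneg fun i _ ↦ abs_nonneg _
  refine ⟨C_E * B + 3 * C, by positivity, fun M hM n hn hnM ↦ ?_⟩
  set ℓ := Real.log M with hℓ
  have hℓ1 : 1 ≤ ℓ := one_le_log_of_three_le hM
  have hℓ0 : 0 < ℓ := by linarith
  have hD := divWeight_nonneg n
  have hE0 := mainConst_nonneg n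
  obtain ⟨hY0, hYℓ⟩ := log_div_nonneg_and_le hM hn hnM
  have hκ : 0 ≤ kappa n := by
    unfold kappa
    exact Finset.sum_nonneg fun p hp ↦ by
      have hp2 : (2 : ℝ) ≤ p := by exact_mod_cast (Nat.prime_of_mem_primeFactors hp).two_le
      exact div_nonneg (Real.log_nonneg (by linarith)) (by linarith)
  have hκℓ : kappa n ≤ ℓ := (kappa_le_log hn).trans
    (Real.log_le_log (by exact_mod_cast Nat.pos_of_ne_zero hn) hnM)
  -- `|R(u)| ≤ B`
  have hu0 : 0 ≤ Real.log (M / n) / ℓ := div_nonneg hY0 hℓ0.le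
  have hu1 : Real.log (M / n) / ℓ ≤ 1 := (div_le_one hℓ0).2 hYℓ
  have hRB : |R.eval (Real.log (M / n) / ℓ)| ≤ B := by
    rw [hB, Polynomial.eval_eq_sum_range]
    refine (Finset.abs_sum_le_sum_abs _ _).trans (Finset.sum_le_sum fun i _ ↦ ?_)
    rw [abs_mul, abs_pow, abs_of_nonneg hu0]
    exact mul_le_of_le_one_right (abs_nonneg _) (pow_le_one₀ hu0 hu1)
  have hm : |mainConst n * R.eval (Real.log (M / n) / ℓ) / ℓ ^ s| ≤ C_E * divWeight n * B / ℓ ^ s := by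
    rw [abs_div, abs_mul, abs_of_nonneg hE0, abs_of_pos (pow_pos hℓ0 _)]
    gcongr
    exact hE n hn
  -- the error is `≤ 3C·D/ℓ^s`
  have herr : C * divWeight n * ((1 + kappa n) / ℓ ^ (s + 1) + 1 / ((1 + Real.log (M / n)) ^ 2 * ℓ ^ s)) ≤
      3 * C * divWeight n / ℓ ^ s := by
    have h1 : (1 + kappa n) / ℓ ^ (s + 1) ≤ 2 / ℓ ^ s := by
      rw [pow_succ, div_le_div_iff₀ (by positivity) (by positivity)]
      have hℓs : 0 < ℓ ^ s := pow_pos hℓ0 s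
      nlinarith [mul_pos hℓs hℓ0]
    have h2 : 1 / ((1 + Real.log (M / n)) ^ 2 * ℓ ^ s) ≤ 1 / ℓ ^ s := by
      apply one_div_le_one_div_of_le (pow_pos hℓ0 _)
      have : 1 ≤ (1 + Real.log (M / n)) ^ 2 := by nlinarith
      nlinarith [pow_pos hℓ0 s]
    calc C * divWeight n * ((1 + kappa n) / ℓ ^ (s + 1) + 1 / ((1 + Real.log (M / n)) ^ 2 * ℓ ^ s))
        ≤ C * divWeight n * (2 / ℓ ^ s + 1 / ℓ ^ s) :=
          mul_le_mul_of_nonneg_left (add_le_add h1 h2) (by positivity)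
      _ = 3 * C * divWeight n / ℓ ^ s := by ring
  have htri : |S M n| ≤ |S M n - mainConst n * R.eval (Real.log (M / n) / ℓ) / ℓ ^ s| +
      |mainConst n * R.eval (Real.log (M / n) / ℓ) / ℓ ^ s| := by
    have := abs_add_le (S M n - mainConst n * R.eval (Real.log (M / n) / ℓ) / ℓ ^ s)
      (mainConst n * R.eval (Real.log (M / n) / ℓ) / ℓ ^ s)
    rwa [sub_add_cancel] at this
  calc |S M n| ≤ 3 * C * divWeight n / ℓ ^ s + C_E * divWeight n * B / ℓ ^ s :=
        htri.trans (add_le_add ((h M hM n hn hnM).trans herr) hm)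
    _ = (C_E * B + 3 * C) * divWeight n / ℓ ^ s := by ring

/-! ### The `(log g)^r` monomials -/

set_option maxHeartbeats 400000 in
/-- **The `(log g)^r`-monomials are error terms** (`r ≥ 1`): under the hypotheses of the product-monomial master step
(two-scale format) there is `C` with, for all `M ≥ 3`,
`|Σ_{c≤⌊M⌋}Σ_{g≤⌊M⌋/c} μ(g)c(log g)^r·Σ_{k₁,k₂≤⌊M⌋/(cg)} y′(cgk₁)y′(cgk₂)t₁(k₁)t₂(k₂)| ≤ C·(1 + log M)^r/log^{s₁+s₂}M`.
[cite: KowalskiMichelVanderKam2000, (23)–(28) — derivation (the log g monomials of the diagonal main term)] -/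
theorem abs_selbergMonomial_logPow_le (P : ℝ[X]) (t₁ t₂ : ℕ → ℝ) (R₁ R₂ : ℝ[X]) (s₁ s₂ : ℕ) {C₁ C₂ : ℝ}
    (hC₁ : 0 ≤ C₁) (hC₂ : 0 ≤ C₂) {r : ℕ} (hr : 1 ≤ r)
    (h₁ : ∀ M : ℝ, 3 ≤ M → ∀ n : ℕ, n ≠ 0 → (n : ℝ) ≤ M →
      |∑ c ∈ Finset.range (P.natDegree + 1), P.coeff c *
          ((∑ k ∈ Icc 1 ⌊M / n⌋₊, (if k.Coprime n then W k else 0) * t₁ k * Real.log (M / n / k) ^ c) /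
            Real.log M ^ c) -
        mainConst n * R₁.eval (Real.log (M / n) / Real.log M) / Real.log M ^ s₁| ≤
        C₁ * divWeight n * ((1 + kappa n) / Real.log M ^ (s₁ + 1) +
          1 / ((1 + Real.log (M / n)) ^ 2 * Real.log M ^ s₁)))
    (h₂ : ∀ M : ℝ, 3 ≤ M → ∀ n : ℕ, n ≠ 0 → (n : ℝ) ≤ M →
      |∑ c ∈ Finset.range (P.natDegree + 1), P.coeff c *
          ((∑ k ∈ Icc 1 ⌊M / n⌋₊, (if k.Coprime n then W k else 0) * t₂ k * Real.log (M / n / k) ^ c) /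
            Real.log M ^ c) -
        mainConst n * R₂.eval (Real.log (M / n) / Real.log M) / Real.log M ^ s₂| ≤
        C₂ * divWeight n * ((1 + kappa n) / Real.log M ^ (s₂ + 1) +
          1 / ((1 + Real.log (M / n)) ^ 2 * Real.log M ^ s₂))) :
    ∃ C : ℝ, 0 < C ∧ ∀ M : ℝ, 3 ≤ M →
      |∑ c ∈ Icc 1 ⌊M⌋₊, ∑ g ∈ Icc 1 (⌊M⌋₊ / c), (μ g : ℝ) * c * Real.log g ^ r *
          ∑ k₁ ∈ Icc 1 (⌊M⌋₊ / (c * g)), ∑ k₂ ∈ Icc 1 (⌊M⌋₊ / (c * g)),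
            ((μ (c * g * k₁) : ℝ) * ((psi (c * g * k₁))⁻¹ *
                P.eval (Real.log (M / ((c * g * k₁ : ℕ) : ℝ)) / Real.log M))) / ((c * g * k₁ : ℕ) : ℝ) *
              (((μ (c * g * k₂) : ℝ) * ((psi (c * g * k₂))⁻¹ *
                P.eval (Real.log (M / ((c * g * k₂ : ℕ) : ℝ)) / Real.log M))) / ((c * g * k₂ : ℕ) : ℝ)) *
              (t₁ k₁ * t₂ k₂)| ≤
        C * (1 + Real.log M) ^ r / Real.log M ^ (s₁ + s₂) := by
  set S₁ : ℝ → ℕ → ℝ := fun M n ↦ ∑ c ∈ Finset.range (P.natDegree + 1), P.coeff c *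
    ((∑ k ∈ Icc 1 ⌊M / n⌋₊, (if k.Coprime n then W k else 0) * t₁ k * Real.log (M / n / k) ^ c) /
      Real.log M ^ c) with hS₁
  set S₂ : ℝ → ℕ → ℝ := fun M n ↦ ∑ c ∈ Finset.range (P.natDegree + 1), P.coeff c *
    ((∑ k ∈ Icc 1 ⌊M / n⌋₊, (if k.Coprime n then W k else 0) * t₂ k * Real.log (M / n / k) ^ c) /
      Real.log M ^ c) with hS₂
  obtain ⟨K₁, hK₁, hb₁⟩ := abs_profileCoord_crude_le R₁ s₁ S₁ hC₁
    (fun M hM n hn hnM ↦ by simpa only [hS₁] using h₁ M hM n hn hnM)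
  obtain ⟨K₂, hK₂, hb₂⟩ := abs_profileCoord_crude_le R₂ s₂ S₂ hC₂
    (fun M hM n hn hnM ↦ by simpa only [hS₂] using h₂ M hM n hn hnM)
  set A : ℝ := (∑' d : ℕ, (d : ℝ) ^ (-(5 / 4 : ℝ))) ^ 2 with hA
  have hA0 : 0 ≤ A := by positivity
  refine ⟨K₁ * K₂ * (48 * A * 3) + 1, by positivity, fun M hM ↦ ?_⟩
  set ℓ := Real.log M with hℓ
  have hℓ1 : 1 ≤ ℓ := one_le_log_of_three_le hM
  have hℓ0 : 0 < ℓ := by linarith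
  have hM0 : 0 < M := by linarith
  set N := ⌊M⌋₊ with hN
  have hN1 : 1 ≤ N := Nat.le_floor (by norm_num; linarith)
  have hlogN : Real.log N ≤ ℓ := Real.log_le_log (by exact_mod_cast hN1) (Nat.floor_le hM0.le)
  have hlogN0 : 0 ≤ Real.log N := Real.log_natCast_nonneg N
  -- factor the inner sums
  have hinner : ∀ c ∈ Icc 1 N, ∀ g ∈ Icc 1 (N / c),
      (μ g : ℝ) * c * Real.log g ^ r * ∑ k₁ ∈ Icc 1 (N / (c * g)), ∑ k₂ ∈ Icc 1 (N / (c * g)),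
        ((μ (c * g * k₁) : ℝ) * ((psi (c * g * k₁))⁻¹ *
            P.eval (Real.log (M / ((c * g * k₁ : ℕ) : ℝ)) / Real.log M))) / ((c * g * k₁ : ℕ) : ℝ) *
          (((μ (c * g * k₂) : ℝ) * ((psi (c * g * k₂))⁻¹ *
            P.eval (Real.log (M / ((c * g * k₂ : ℕ) : ℝ)) / Real.log M))) / ((c * g * k₂ : ℕ) : ℝ)) *
          (t₁ k₁ * t₂ k₂) =
      (μ g : ℝ) * c * Real.log g ^ r * (W (c * g) ^ 2 * (S₁ M (c * g) * S₂ M (c * g))) := by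
    intro c hc g hg
    have hc0 : c ≠ 0 := by have := (Finset.mem_Icc.1 hc).1; omega
    have hg0 : g ≠ 0 := by have := (Finset.mem_Icc.1 hg).1; omega
    rw [hN, selbergInner_eq_W_sq_mul P M (mul_ne_zero hc0 hg0) t₁ t₂]
  rw [Finset.sum_congr rfl fun c hc ↦ Finset.sum_congr rfl fun g hg ↦ hinner c hc g hg]
  -- collapse bound
  have hcoll := abs_selbergCollapse_logPow_le hr N (fun n ↦ S₁ M n * S₂ M n)
  refine hcoll.trans ?_
  -- the `n`-sum: `|W|κ|S₁S₂| ≤ κD²K₁K₂/(n ℓ^{s₁+s₂})`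
  have hterm : ∀ n ∈ Icc 1 N, |W n| * kappa n * |S₁ M n * S₂ M n| ≤
      K₁ * K₂ / ℓ ^ (s₁ + s₂) * (kappa n * divWeight n ^ 2 / n) := by
    intro n hn
    have hn' := Finset.mem_Icc.1 hn
    have hn0 : n ≠ 0 := by omega
    have hnM : (n : ℝ) ≤ M := le_trans (by exact_mod_cast hn'.2) (Nat.floor_le hM0.le)
    have hD := divWeight_nonneg n
    have hκ : 0 ≤ kappa n := by
      unfold kappa
      exact Finset.sum_nonneg fun p hp ↦ by
        have hp2 : (2 : ℝ) ≤ p := by exact_mod_cast (Nat.prime_of_mem_primeFactors hp).two_le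
        exact div_nonneg (Real.log_nonneg (by linarith)) (by linarith)
    have hW := abs_W_le n
    have hS := mul_le_mul (hb₁ M hM n hn0 hnM) (hb₂ M hM n hn0 hnM) (abs_nonneg _) (by positivity)
    rw [← abs_mul] at hS
    have hn0' : (0 : ℝ) < n := by exact_mod_cast Nat.pos_of_ne_zero hn0
    calc |W n| * kappa n * |S₁ M n * S₂ M n|
        ≤ (n : ℝ)⁻¹ * kappa n * (K₁ * divWeight n / ℓ ^ s₁ * (K₂ * divWeight n / ℓ ^ s₂)) := by
          gcongr
      _ = K₁ * K₂ / ℓ ^ (s₁ + s₂) * (kappa n * divWeight n ^ 2 / n) := by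
          rw [pow_add]; field_simp
  have hsum : ∑ n ∈ Icc 1 N, |W n| * kappa n * |S₁ M n * S₂ M n| ≤
      K₁ * K₂ / ℓ ^ (s₁ + s₂) * (48 * A * (3 * ℓ)) := by
    calc _ ≤ ∑ n ∈ Icc 1 N, K₁ * K₂ / ℓ ^ (s₁ + s₂) * (kappa n * divWeight n ^ 2 / n) := Finset.sum_le_sum hterm
      _ = K₁ * K₂ / ℓ ^ (s₁ + s₂) * ∑ n ∈ Icc 1 N, kappa n * divWeight n ^ 2 / n := by rw [Finset.mul_sum]
      _ ≤ K₁ * K₂ / ℓ ^ (s₁ + s₂) * (48 * A * (2 + Real.log N)) := by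
          refine mul_le_mul_of_nonneg_left ?_ (by positivity)
          have := sum_kappa_divWeight_sq_div_le hN1
          rw [← hA] at this
          exact this
      _ ≤ K₁ * K₂ / ℓ ^ (s₁ + s₂) * (48 * A * (3 * ℓ)) := by
          gcongr; linarith
  have hpow : Real.log N ^ (r - 1) ≤ (1 + ℓ) ^ (r - 1) := pow_le_pow_left₀ hlogN0 (by linarith) _
  calc Real.log N ^ (r - 1) * ∑ n ∈ Icc 1 N, |W n| * kappa n * |S₁ M n * S₂ M n|
      ≤ (1 + ℓ) ^ (r - 1) * (K₁ * K₂ / ℓ ^ (s₁ + s₂) * (48 * A * (3 * ℓ))) :=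
        mul_le_mul hpow hsum (Finset.sum_nonneg fun n _ ↦ by
          have : 0 ≤ kappa n := by
            unfold kappa
            exact Finset.sum_nonneg fun p hp ↦ by
              have hp2 : (2 : ℝ) ≤ p := by exact_mod_cast (Nat.prime_of_mem_primeFactors hp).two_le
              exact div_nonneg (Real.log_nonneg (by linarith)) (by linarith)
          positivity) (by positivity)
    _ = K₁ * K₂ * (48 * A * 3) * ((1 + ℓ) ^ (r - 1) * ℓ) / ℓ ^ (s₁ + s₂) := by ring
    _ ≤ K₁ * K₂ * (48 * A * 3) * (1 + ℓ) ^ r / ℓ ^ (s₁ + s₂) := by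
        have e : r = (r - 1) + 1 := by omega
        have hle : (1 + ℓ) ^ (r - 1) * ℓ ≤ (1 + ℓ) ^ r := by
          conv_rhs => rw [e, pow_succ]
          exact mul_le_mul_of_nonneg_left (by linarith) (by positivity)
        gcongr
    _ ≤ (K₁ * K₂ * (48 * A * 3) + 1) * (1 + ℓ) ^ r / ℓ ^ (s₁ + s₂) := by
        gcongr; linarith

end Summit.Parity.GeneralizedHardyLittlewood.Theorems.MomentsBeyondDiagonal.DiagKernel

end
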